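import Summits.BirchSwinnertonDyer.BirchSwinnertonDyer.Theorems.CyclotomicUntwistPSLocalThreeTorsionEt
import Summits.BirchSwinnertonDyer.BirchSwinnertonDyer.Theorems.CyclotomicUntwistPSLocalThreeTorsionStar
import HarnessLib

/-!
# LAW L-t3 on the Kodaira-`II` rows, part 1 (SHAPE): on Tate's type-`II` normal form with `v(Δ) = 4` at
# `3`, `Ψ₃` has at most one root in `K_v`; and a `ℚ₃`-root exists whenever `2·v₃c₆ ≤ 3·v₃c₄ + 1`

Cell `pub/bsd-wall` (D-0145 line `route-BirchSwinnertonDyer-CyclotomicUntwist`), seat `bsd-line-cycu-p2`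
(prover seat 2/3, gen 3), helper toward K1 `PSRankOneLowerHalfAtThree` (stmt-BirchSwinnertonDyer-21580)
and K2 `PSRankOneUpperHalfAtThree` (stmt-21581): the local condition at `3` of a `3`-descent on the
principal-series rows (row `II`, `v₃Δ_min = 4`). THEOREMS ONLY (no definition, no named fact, no `sorry`);
BSD is not proved by this file and no crux is. Consumed by part 2 (`…PSLocalThreeTorsionII.lean`:
`W(ℚ₃)[3] ≠ 0 ⟺ c₆(W_ℤ)/3³ ≡ 1 (mod 3)` on the `II` rows).

## Method (Kodaira `II`, `v(Δ) = 4`, `π = 3`)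
Tate's Step-3 normal form over `K_v = ℚ_{(3)}` (Literature `exists_variableChange_b_of_kodairaSymbolAt_wild`:
`b₂ = πβ₂`, `b₄ = πβ₄`, `b₆ = πβ₆`, `Δ = π⁴δ` with `δ` a unit) forces `w b₈ = e⁻²` (§1: if `w b₄ = e⁻¹` then
`8b₄³` dominates `Δ` strictly at `e⁻³`; then `w b₈ ≤ e⁻²`, and `w b₈ < e⁻²` puts every term of `Δ` at most
`e⁻⁵`) — so the model is on the "type-III shape" of the O5 file `NonSplitAtThreeLocal.lean`, whose
`root_eq_root_of_shapeIII` says `Ψ₃` has at most ONE root in `K_v` (the three other roots have valuation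
`1/3`): §2, transported to `ℚ_[3]` in §3. Existence of a `ℚ₃`-root (§3, any `W` with `c₄c₆ ≠ 0`,
`2·v₃c₆ ≤ 3·v₃c₄ + 1`) is the V10 Newton-polygon lemma `psi3_exists_root_valuation_of_lt` on the short
model, shifted back (`u = 1`).
References: J. H. Silverman, *Advanced Topics in the Arithmetic of Elliptic Curves* (1994), IV.9.4 Step 3 and
Table 4.1 [SilvermanATAEC1994]; J.-P. Serre, Invent. Math. 15 (1972), §1.11 [Serre1972].
-/

set_option autoImplicit false
-- single-conjunct summit: `Summit.BirchSwinnertonDyer.BirchSwinnertonDyer.…` repeats the name by design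
set_option linter.dupNamespace false

noncomputable section

open scoped Classical

open Polynomial WeierstrassCurve IsDedekindDomain IsDedekindDomain.HeightOneSpectrum WithZero
  Rat.HeightOneSpectrum Literature.NumberTheory.EllipticCurves
  Literature.NumberTheory.EllipticCurves.Rank1Residual Literature.NumberTheory.DiophantineGeometry
  Summit.BirchSwinnertonDyer.Rank1Residual.Additive Summit.BirchSwinnertonDyer.Rank1Residual.O5
  Summit.BirchSwinnertonDyer.Rank1Residual.O5.NonSplitAtThree
  Summit.BirchSwinnertonDyer.Rank1Residual.Additive.PsiThreeAdic
  Summit.BirchSwinnertonDyer.Rank1Residual.GaloisImage.LocalTorsion3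

open Summit.BirchSwinnertonDyer.Rank1Residual.Additive.ThreeAdicLift (le_exp_sub_one_of_lt_exp)

namespace Summit.BirchSwinnertonDyer.BirchSwinnertonDyer.Theorems.PSLocalThreeTorsion

/-! ## §1 Valued-field algebra: the type-`II` shape with `w Δ = e⁻⁴` is on the type-III shape -/

section Valued

variable {F : Type*} [Field F] (w : Valuation F ℤᵐ⁰) {ϖ : F}

/-- **Type-`II` shape with `w Δ = exp (−4)` ⟹ `w b₈ = exp (−2)`.** On `w b₂ ≤ e⁻¹`, `w b₄ ≤ e⁻¹`,
`w b₆ ≤ e⁻¹` with `4b₈ = b₂b₆ − b₄²` and `w Δ = e⁻⁴` (`Δ = −b₂²b₈ − 8b₄³ − 27b₆² + 9b₂b₄b₆`): first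
`w b₄ ≤ e⁻²` (otherwise `8b₄³` has valuation `e⁻³` and dominates strictly), then `w b₈ ≤ e⁻²`, and
`w b₈ < e⁻²` would put every term of `Δ` at most `e⁻⁵`. [cite: SilvermanATAEC1994, IV.9.4 Step 3 (type II)] -/
theorem map_b₈_of_shapeII_four (h3 : (3 : F) = ϖ) (hϖ : w ϖ = exp (-1 : ℤ)) {b₂ b₄ b₆ b₈ : F}
    (hb₂ : w b₂ ≤ exp (-1 : ℤ)) (hb₄ : w b₄ ≤ exp (-1 : ℤ)) (hb₆ : w b₆ ≤ exp (-1 : ℤ))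
    (hrel : 4 * b₈ = b₂ * b₆ - b₄ ^ 2)
    (hΔ : w (-b₂ ^ 2 * b₈ - 8 * b₄ ^ 3 - 27 * b₆ ^ 2 + 9 * b₂ * b₄ * b₆) = exp (-4 : ℤ)) :
    w b₈ = exp (-2 : ℤ) := by
  obtain ⟨w4, w8, -, w27, w9⟩ := map_consts w h3 hϖ
  have hT3 : w (27 * b₆ ^ 2) ≤ exp (-5 : ℤ) := by
    rw [map_mul, map_pow]
    calc w 27 * w b₆ ^ 2 ≤ exp (-3 : ℤ) * exp (-1 : ℤ) ^ 2 := mul_le_mul' w27 (pow_le_pow_left' hb₆ 2)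
      _ = exp (-5 : ℤ) := by rw [← exp_nsmul, ← exp_add]; norm_num
  -- `w b₈ ≤ e⁻²` in any case
  have hb₈le : w b₈ ≤ exp (-2 : ℤ) := by
    have h : w (4 * b₈) ≤ exp (-2 : ℤ) := by
      rw [hrel]
      refine Valuation.map_sub_le w ?_ ?_
      · calc w (b₂ * b₆) ≤ exp (-1 + -1 : ℤ) := map_mul_le_exp_add w hb₂ hb₆
          _ = exp (-2 : ℤ) := by norm_num
      · rw [map_pow]
        calc w b₄ ^ 2 ≤ exp (-1 : ℤ) ^ 2 := pow_le_pow_left' hb₄ 2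
          _ = exp (-2 : ℤ) := by rw [← exp_nsmul]; norm_num
    rwa [map_mul, w4, one_mul] at h
  have hT1 : w (-b₂ ^ 2 * b₈) ≤ exp (-4 : ℤ) := by
    rw [Valuation.map_mul, Valuation.map_neg, map_pow]
    calc w b₂ ^ 2 * w b₈ ≤ exp (-1 : ℤ) ^ 2 * exp (-2 : ℤ) := mul_le_mul' (pow_le_pow_left' hb₂ 2) hb₈le
      _ = exp (-4 : ℤ) := by rw [← exp_nsmul, ← exp_add]; norm_num
  -- Step 1: `w b₄ ≤ e⁻²`
  have hb₄' : w b₄ ≤ exp (-2 : ℤ) := by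
    rcases hb₄.eq_or_lt with h4eq | h4lt
    · exfalso
      have hT2 : w (8 * b₄ ^ 3) = exp (-3 : ℤ) := by
        rw [map_mul, map_pow, w8, one_mul, h4eq, ← exp_nsmul]; norm_num
      have hT4 : w (9 * b₂ * b₄ * b₆) ≤ exp (-5 : ℤ) := by
        rw [map_mul, map_mul, map_mul, h4eq]
        calc w 9 * w b₂ * exp (-1 : ℤ) * w b₆ ≤ exp (-2 : ℤ) * exp (-1 : ℤ) * exp (-1 : ℤ) * exp (-1 : ℤ) :=
              mul_le_mul' (mul_le_mul' (mul_le_mul' w9 hb₂) le_rfl) hb₆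
          _ = exp (-5 : ℤ) := by rw [← exp_add, ← exp_add, ← exp_add]; norm_num
      have l1 : w (-b₂ ^ 2 * b₈) < w (8 * b₄ ^ 3) := by
        rw [hT2]; exact lt_of_le_of_lt hT1 (by rw [exp_lt_exp]; norm_num)
      have e1 : w (-b₂ ^ 2 * b₈ - 8 * b₄ ^ 3) = exp (-3 : ℤ) := by
        rw [Valuation.map_sub_eq_of_lt_right w l1, hT2]
      have l2 : w (27 * b₆ ^ 2) < w (-b₂ ^ 2 * b₈ - 8 * b₄ ^ 3) := by
        rw [e1]; exact lt_of_le_of_lt hT3 (by rw [exp_lt_exp]; norm_num)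
      have e2 : w (-b₂ ^ 2 * b₈ - 8 * b₄ ^ 3 - 27 * b₆ ^ 2) = exp (-3 : ℤ) := by
        rw [Valuation.map_sub_eq_of_lt_left w l2, e1]
      have l3 : w (9 * b₂ * b₄ * b₆) < w (-b₂ ^ 2 * b₈ - 8 * b₄ ^ 3 - 27 * b₆ ^ 2) := by
        rw [e2]; exact lt_of_le_of_lt hT4 (by rw [exp_lt_exp]; norm_num)
      have e3 : w (-b₂ ^ 2 * b₈ - 8 * b₄ ^ 3 - 27 * b₆ ^ 2 + 9 * b₂ * b₄ * b₆) = exp (-3 : ℤ) := by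
        rw [Valuation.map_add_eq_of_lt_left w l3, e2]
      rw [hΔ, exp_inj] at e3
      norm_num at e3
    · have := le_exp_sub_one_of_lt_exp h4lt
      rwa [show (-1 : ℤ) - 1 = -2 by norm_num] at this
  have hT2 : w (8 * b₄ ^ 3) ≤ exp (-6 : ℤ) := by
    rw [map_mul, map_pow, w8, one_mul]
    calc w b₄ ^ 3 ≤ exp (-2 : ℤ) ^ 3 := pow_le_pow_left' hb₄' 3
      _ = exp (-6 : ℤ) := by rw [← exp_nsmul]; norm_num
  have hT4 : w (9 * b₂ * b₄ * b₆) ≤ exp (-6 : ℤ) := by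
    rw [map_mul, map_mul, map_mul]
    calc w 9 * w b₂ * w b₄ * w b₆ ≤ exp (-2 : ℤ) * exp (-1 : ℤ) * exp (-2 : ℤ) * exp (-1 : ℤ) :=
          mul_le_mul' (mul_le_mul' (mul_le_mul' w9 hb₂) hb₄') hb₆
      _ = exp (-6 : ℤ) := by rw [← exp_add, ← exp_add, ← exp_add]; norm_num
  -- Step 2: `w b₈ < e⁻²` is impossible
  rcases hb₈le.eq_or_lt with h8eq | h8lt
  · exact h8eq
  · exfalso
    have hb₈' : w b₈ ≤ exp (-3 : ℤ) := by
      have := le_exp_sub_one_of_lt_exp h8lt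
      rwa [show (-2 : ℤ) - 1 = -3 by norm_num] at this
    have hT1' : w (-b₂ ^ 2 * b₈) ≤ exp (-5 : ℤ) := by
      rw [Valuation.map_mul, Valuation.map_neg, map_pow]
      calc w b₂ ^ 2 * w b₈ ≤ exp (-1 : ℤ) ^ 2 * exp (-3 : ℤ) :=
            mul_le_mul' (pow_le_pow_left' hb₂ 2) hb₈'
        _ = exp (-5 : ℤ) := by rw [← exp_nsmul, ← exp_add]; norm_num
    have hle : w (-b₂ ^ 2 * b₈ - 8 * b₄ ^ 3 - 27 * b₆ ^ 2 + 9 * b₂ * b₄ * b₆) ≤ exp (-5 : ℤ) :=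
      Valuation.map_add_le w (Valuation.map_sub_le w (Valuation.map_sub_le w hT1'
        (hT2.trans (by rw [exp_le_exp]; norm_num))) hT3) (hT4.trans (by rw [exp_le_exp]; norm_num))
    rw [hΔ, exp_le_exp] at hle
    norm_num at hle

end Valued

/-! ## §2 Over the completion `K_v`: `Ψ₃` has at most one root on the type-`II` shape with `v(Δ) = 4` -/

section Completion

variable {A : Type*} [CommRing A] [IsDedekindDomain A] {K : Type*} [Field K] [Algebra A K]
  [IsFractionRing A K] (v : HeightOneSpectrum A)

/-- **Type `II` with `v(Δ) = 4`: `Ψ₃` has at most one root in `K_v`.** On a `K_v`-model with `b₂ = πβ₂`,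
`b₄ = πβ₄`, `b₆ = πβ₆`, `Δ = π⁴δ` (`βᵢ ∈ 𝒪_v`, `δ ∈ 𝒪_v^×`; Tate's Step-3 normal form) and `π = 3` in
`K_v`: `w b₈ = e⁻²` (§1), so the model is on the type-III shape and any two `K_v`-roots of `Ψ₃` coincide
(`NonSplitAtThree.root_eq_root_of_shapeIII`). [cite: SilvermanATAEC1994, IV.9.4 Step 3 (normal form of type II)] -/
theorem Ψ₃_root_unique_of_shapeII_four {π : K} (hπ : v.valuation K π = exp (-1 : ℤ))
    (h3 : (π : v.adicCompletion K) = 3) (N : WeierstrassCurve (v.adicCompletion K))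
    (β₂ β₄ β₆ δ : v.adicCompletionIntegers K) (hδ : IsUnit δ)
    (hb₂ : N.b₂ = (π : v.adicCompletion K) ^ 1 * β₂)
    (hb₄ : N.b₄ = (π : v.adicCompletion K) ^ 1 * β₄)
    (hb₆ : N.b₆ = (π : v.adicCompletion K) ^ 1 * β₆)
    (hΔ : N.Δ = (π : v.adicCompletion K) ^ 4 * δ) (x y : v.adicCompletion K)
    (hx : N.Ψ₃.eval x = 0) (hy : N.Ψ₃.eval y = 0) : x = y := by
  set w : Valuation (v.adicCompletion K) ℤᵐ⁰ := Valued.v with hw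
  set ϖ : v.adicCompletion K := (π : v.adicCompletion K) with hϖ
  have hπv : w ϖ = exp (-1 : ℤ) := by rw [hw, hϖ, valuedAdicCompletion_eq_valuation', hπ]
  have hint : ∀ β : v.adicCompletionIntegers K, w (β : v.adicCompletion K) ≤ 1 := fun β ↦ β.2
  have hunit : ∀ {β : v.adicCompletionIntegers K}, IsUnit β → w (β : v.adicCompletion K) = 1 :=
    fun hβ ↦ valued_coe_eq_one_of_isUnit v hβ
  have h3' : (3 : v.adicCompletion K) = ϖ := h3.symm
  have hle : ∀ β : v.adicCompletionIntegers K,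
      w ((π : v.adicCompletion K) ^ 1 * (β : v.adicCompletion K)) ≤ exp (-1 : ℤ) := by
    intro β
    rw [pow_one, map_mul, ← hϖ, hπv]
    calc exp (-1 : ℤ) * w (β : v.adicCompletion K) ≤ exp (-1 : ℤ) * 1 := mul_le_mul' le_rfl (hint β)
      _ = exp (-1 : ℤ) := mul_one _
  have wb₂ : w N.b₂ ≤ exp (-1 : ℤ) := hb₂ ▸ hle β₂
  have wb₄ : w N.b₄ ≤ exp (-1 : ℤ) := hb₄ ▸ hle β₄
  have wb₆ : w N.b₆ ≤ exp (-1 : ℤ) := hb₆ ▸ hle β₆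
  have wΔ : w (-N.b₂ ^ 2 * N.b₈ - 8 * N.b₄ ^ 3 - 27 * N.b₆ ^ 2 + 9 * N.b₂ * N.b₄ * N.b₆) =
      exp (-4 : ℤ) := by
    rw [show -N.b₂ ^ 2 * N.b₈ - 8 * N.b₄ ^ 3 - 27 * N.b₆ ^ 2 + 9 * N.b₂ * N.b₄ * N.b₆ = N.Δ from rfl,
      hΔ, map_mul, map_pow, hπv, hunit hδ, mul_one, ← exp_nsmul]
    simp
  have wb₈ : w N.b₈ = exp (-2 : ℤ) := map_b₈_of_shapeII_four w h3' hπv wb₂ wb₄ wb₆ N.b_relation wΔ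
  rw [WeierstrassCurve.eval_Ψ₃_eq] at hx hy
  exact NonSplitAtThree.root_eq_root_of_shapeIII w h3' hπv wb₂ wb₄ wb₆ wb₈ hx hy

end Completion

/-! ## §3 Curves over `ℚ`: the Kodaira-`II` rows (`v₃Δ_min = 4`) -/

section Curves

variable (W : WeierstrassCurve ℚ) [W.IsElliptic]

/-- **Kodaira `II` at `3` with `ord₃ Δ_min = 4` ⟹ `Ψ₃` has at most one root in the completion
`ℚ_{(3)}`** (Tate's Step-3 normal form over `K_v`, Literature `exists_variableChange_b_of_kodairaSymbolAt_wild`,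
feeds §2; root-uniqueness transfers down the change of variables). [cite: SilvermanATAEC1994, IV.9.4 Step 3 and Table 4.1] -/
theorem Ψ₃_root_unique_adicCompletion_of_kodairaII
    (hT : W.kodairaSymbolAt (placeOf 3) = .II) (hord : W.ordMinimalDiscriminant (placeOf 3) = 4)
    (x y : (placeOf 3).adicCompletion ℚ)
    (hx : (W.baseChange ((placeOf 3).adicCompletion ℚ)).Ψ₃.eval x = 0)
    (hy : (W.baseChange ((placeOf 3).adicCompletion ℚ)).Ψ₃.eval y = 0) : x = y := by
  haveI : PerfectField (IsLocalRing.ResidueField ((placeOf 3).adicCompletionIntegers ℚ)) :=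
    PerfectField.ofFinite
  have h2 : ringChar (ℤ ⧸ (placeOf 3).asIdeal) ≠ 2 := by rw [ringChar_int_quot_placeOf 3]; decide
  have hgen : natGenerator (placeOf 3) = 3 :=
    Literature.NumberTheory.EllipticCurves.Rat.natGenerator_primesEquiv_symm ⟨3, Nat.prime_three⟩
  have hπ : (placeOf 3).valuation ℚ (3 : ℚ) = exp (-1 : ℤ) := by
    have h := valuation_natGenerator_int (placeOf 3)
    rwa [hgen, Nat.cast_ofNat] at h
  have h3 : algebraMap ℚ ((placeOf 3).adicCompletion ℚ) 3 = 3 := map_ofNat _ 3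
  obtain ⟨C, β₂, β₄, β₆, δ, -, hδ, hb₂, hb₄, hb₆, hΔ⟩ :=
    W.exists_variableChange_b_of_kodairaSymbolAt_wild (placeOf 3) h2 (Or.inl ⟨hT, rfl, rfl, rfl⟩) hπ
  rw [hord] at hΔ
  exact Ψ₃_root_unique_of_variableChange _ C
    (Ψ₃_root_unique_of_shapeII_four (placeOf 3) hπ h3 _ β₂ β₄ β₆ δ hδ hb₂ hb₄ hb₆ hΔ) x y hx hy

/-- **Kodaira `II` at `3` with `ord₃ Δ_min = 4` ⟹ `Ψ₃` has at most one root in `ℚ₃`** (transport along the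
`ℚ`-algebra isomorphism `Padic.adicCompletionEquiv : ℚ_[3] ≃ ℚ_{(3)}`). [cite: SilvermanATAEC1994, IV.9.4 Step 3] -/
theorem Ψ₃_root_unique_padic_of_kodairaII
    (hT : W.kodairaSymbolAt (placeOf 3) = .II) (hord : W.ordMinimalDiscriminant (placeOf 3) = 4)
    (r s : ℚ_[3]) (hr : ((W.baseChange ℚ_[3]).Ψ₃).IsRoot r) (hs : ((W.baseChange ℚ_[3]).Ψ₃).IsRoot s) :
    r = s := by
  set Kv := (placeOf 3).adicCompletion ℚ
  let e : ℚ_[3] ≃ₐ[ℚ] Kv := (Padic.adicCompletionEquiv ℤ ⟨3, Nat.prime_three⟩).toAlgEquiv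
  have he : ∀ c : ℚ_[3], ((W.baseChange ℚ_[3]).Ψ₃).IsRoot c → (W.baseChange Kv).Ψ₃.eval (e c) = 0 := by
    intro c hc
    rw [IsRoot.def, WeierstrassCurve.baseChange, map_Ψ₃, eval_map, ← aeval_def] at hc
    rw [WeierstrassCurve.baseChange, map_Ψ₃, eval_map, ← aeval_def, aeval_algHom_apply, hc, map_zero]
  exact e.injective (Ψ₃_root_unique_adicCompletion_of_kodairaII W hT hord (e r) (e s) (he r hr) (he s hs))

omit [W.IsElliptic] in
/-- **A `ℚ₃`-root of `Ψ₃` exists whenever `c₄c₆ ≠ 0` and `2·v₃c₆ ≤ 3·v₃c₄ + 1`** (the length-one first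
segment of the Newton polygon of the short model's `3x⁴ + 6Ax² + 12Bx − A²`, `A = −c₄/48`, `B = −c₆/864`;
V10 `psi3_exists_root_valuation_of_lt`, shifted back by `x ↦ x + r`, `u = 1`). [cite: Serre1972, §1.11] -/
theorem exists_isRoot_Ψ₃_padic_of_le (h₄ : W.c₄ ≠ 0) (h₆ : W.c₆ ≠ 0)
    (hreg : 2 * padicValRat 3 W.c₆ ≤ 3 * padicValRat 3 W.c₄ + 1) :
    ∃ x : ℚ_[3], ((W.baseChange ℚ_[3]).Ψ₃).IsRoot x := by
  have hu : W.toShortNF.u = 1 := toShortNF_u_eq_one' W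
  haveI hSh : (W.toShortNF • W).IsShortNF := W.toShortNF_spec
  have hc₄ : (W.toShortNF • W).c₄ = W.c₄ := by
    rw [variableChange_c₄, hu, inv_one, Units.val_one, one_pow, one_mul]
  have hc₆ : (W.toShortNF • W).c₆ = W.c₆ := by
    rw [variableChange_c₆, hu, inv_one, Units.val_one, one_pow, one_mul]
  have hA : (W.toShortNF • W).a₄ = -W.c₄ / 48 := by
    have h := (W.toShortNF • W).c₄_of_isShortNF
    rw [hc₄] at h
    rw [h]; ring
  have hB : (W.toShortNF • W).a₆ = -W.c₆ / 864 := by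
    have h := (W.toShortNF • W).c₆_of_isShortNF
    rw [hc₆] at h
    rw [h]; ring
  have hA0 : (W.toShortNF • W).a₄ ≠ 0 := by
    rw [hA]; exact div_ne_zero (neg_ne_zero.mpr h₄) (by norm_num)
  have hB0 : (W.toShortNF • W).a₆ ≠ 0 := by
    rw [hB]; exact div_ne_zero (neg_ne_zero.mpr h₆) (by norm_num)
  have hvA : padicValRat 3 (W.toShortNF • W).a₄ = padicValRat 3 W.c₄ - 1 := by
    rw [hA, padicValRat.div (neg_ne_zero.mpr h₄) (by norm_num), padicValRat.neg,
      padicValRat_three_fortyeight]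
  have hvB : padicValRat 3 (W.toShortNF • W).a₆ = padicValRat 3 W.c₆ - 3 := by
    rw [hB, padicValRat.div (neg_ne_zero.mpr h₆) (by norm_num), padicValRat.neg, padicValRat_three_864]
  have hlt : 2 * padicValRat 3 (W.toShortNF • W).a₆ + 2 ≤ 3 * padicValRat 3 (W.toShortNF • W).a₄ := by
    rw [hvA, hvB]; omega
  obtain ⟨x, -, -, hx⟩ := psi3_exists_root_valuation_of_lt hA0 hB0 hlt
  refine ⟨x + (W.toShortNF.r : ℚ_[3]), ?_⟩
  rw [IsRoot.def, ← eval_Ψ₃_baseChange_smul_of_u_eq_one W W.toShortNF hu x,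
    eval_Ψ₃_baseChange_of_isShortNF]
  exact hx

end Curves

end Summit.BirchSwinnertonDyer.BirchSwinnertonDyer.Theorems.PSLocalThreeTorsion

end
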